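import Summits.RiemannHypothesis.RiemannHypothesis.Theorems.PfPersistenceDilationProfile
import Summits.RiemannHypothesis.RiemannHypothesis.Theorems.GroundBartaEvenWinsBeyondArchDeflationForms
import HarnessLib

/-!
# The dilation defect of a Weil ground state: the profile excess IS the defect energy
# (pub-rhpf, theory-2 gen 4; RH-free helper for crux `EvenSectorBarta.EvenOneSignedWindows`,
# item stmt-RiemannHypothesis-19953)

**mechanism/rigidity campaign; no RH claims.**  Companion text:
`run/shared/lean/pub/pub-rhpf/pub-rhpf-theory-2/THEORY-2d.md` (§1).  This is the kernel form of
the DILATION-DEFECT IDENTITY of THEORY-2b §B2 (there: DERIVED for eigenfunctions of a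
self-adjoint model), now PROVED for every Weil ground state of every window, with no simplicity,
regularity or eigen-equation hypothesis: only the variational characterisation of the bottom.

Notation: `ũ = weilTrunc a u` (the ground state, vanishing at every `|x| ≥ a`),
`ũ_η = weilDilate η ũ` (Bombieri's unitary dilation, living on the window `a/(1+η)`),
`w_η = ũ_η − ũ = weilDilationDefect a u η` (the DILATION DEFECT), and the WINDOW DEFECT FORM
`D_a(f) = P(f) + 𝓔_a(f) − (M_a + ε(a)) ‖f‖²` (`windowDefectForm`; the closed Weil form of the window
measured from its bottom `ε(a) = weilGroundEnergy a`), with polarisation `D_a(f, h)`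
(`windowDefectForm₂`).  On the finite-energy window class
`𝒟_a = {f ∈ L² : f = 0 on |x| ≥ a, ∫₀^∞ ρ D_t(f) dt < ∞}`:

* `windowDefectForm_nonneg`: `D_a ≥ 0` on `𝒟_a` (`stub_formDomainPos`);
* `windowDefectForm_weilTrunc`: `D_a(ũ) = 0` (`stub_groundStateEnergy`);
* `windowDefectForm_add_smul`: `D_a(f + s h) = D_a(f) + 2s D_a(f, h) + s² D_a(h)` (the bilinear
  bookkeeping of `GroundBartaEvenWinsBeyondArchDeflation{Increments,Forms}`);
* `windowDefectForm₂_sq_le`: CAUCHY–SCHWARZ `D_a(f, h)² ≤ D_a(f) D_a(h)` (discriminant of the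
  nonnegative quadratic `s ↦ D_a(f + s h)`), hence the FIRST VARIATION
  `windowDefectForm₂_weilTrunc`: `D_a(ũ, h) = 0` for every `h ∈ 𝒟_a` — the Euler–Lagrange equation
  of the ground state in closed-form language, obtained without the weak equation;
* `windowDefectForm_eq_sub_weilTrunc` (PYTHAGORAS AT THE BOTTOM): `D_a(g) = D_a(g − ũ)` for every
  `g ∈ 𝒟_a`;
* `weilDilationProfile_sub_weilGroundEnergy` (THE DEFECT IDENTITY, `0 ≤ η ≤ 1`):
  `weilDilationProfile a u η − ε(a) = D_a(w_η)` — the excess of the dilation profile over the ground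
  level is EXACTLY the defect energy of the dilation defect;
* `tendsto_windowDefectForm_weilDilationDefect_div` (VIRIAL = DEFECT RATE): if the profile has a
  derivative `V` at `η = 0` (the dilation virial; `= −a ε′(a)` at a.e. window,
  `PfPersistenceEdgeLaw`), then `D_a(w_η)/η → V` as `η → 0⁺`.

So the log-Pohozaev reading `V = 2c₀ · a · I` of the edge law (`WeilLogPohozaevAt`, typed in
`PfPersistenceDilationProfile`, DERIVED not proved) is reduced to an asymptotic statement about the
defect energy of ONE explicit family `w_η`, which concentrates in the two edge layers
`a/(1+η) ≤ |x| < a` (where `w_η = −ũ`); the layer computation is in the sibling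
`PfPersistenceEdgeLawLayer`.  Everything here is sorry-free and RH-free.

References: E. Bombieri, Rend. Mat. Acc. Lincei (9) 11 (2000) 183–233, §4 (Thm 3; proof of Thm 5:
the dilation); M. Fukushima, Y. Oshima, M. Takeda, *Dirichlet Forms and Symmetric Markov
Processes* (2011) §1.1; X. Ros-Oton, J. Serra, ARMA 213 (2014) 587–628 (the fractional Pohozaev
identity, of which this is the order-zero bookkeeping).
-/

set_option linter.dupNamespace false

noncomputable section

open MeasureTheory Set Filter
open scoped Topology ComplexConjugate

namespace Summit.RiemannHypothesis.RiemannHypothesis.Theorems.PfPersistence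

open Literature.NumberTheory.LFunctions
open Summit.RiemannHypothesis.RiemannHypothesis.Theorems.WeilWindowFlowWindowLipschitz
  (stub_formDomainPos stub_groundStateEnergy stub_localizedCut_energy_window)
open Summit.RiemannHypothesis.RiemannHypothesis.Theorems.OddSector
  (weilIncrement₂ weilDirichletEnergy₂ weilPoleForm₂ memLp_weilDilate)
open Summit.RiemannHypothesis.RiemannHypothesis.Theorems.EvenWinsBeyondArch

variable {a : ℝ} {u f g h : ℝ → ℂ}

/-! ## The window defect form and its polarisation -/

/-- The **window defect form** `D_a(f) = P(f) + 𝓔_a(f) − (M_a + ε(a)) ‖f‖²`: the closed Weil form of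
the window `[-a, a]` measured from its bottom `ε(a)`. [cite: Bombieri2000Weil, §4 Thm 3] -/
def windowDefectForm (a : ℝ) (f : ℝ → ℂ) : ℝ :=
  weilPoleForm f + weilDirichletEnergy a f -
    (weilMarkovConstant a + weilGroundEnergy a) * ∫ x, ‖f x‖ ^ 2

/-- The **polarised window defect form** `D_a(f, h) = P(f, h) + 𝓔_a(f, h) − (M_a + ε(a)) ∫ Re(f h̄)`.
[folklore] -/
def windowDefectForm₂ (a : ℝ) (f h : ℝ → ℂ) : ℝ :=
  weilPoleForm₂ f h + weilDirichletEnergy₂ a f h -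
    (weilMarkovConstant a + weilGroundEnergy a) * ∫ x, (f x * conj (h x)).re

/-- The **dilation defect** `w_η = ũ_η − ũ` of a window state (`ũ = weilTrunc a u`,
`ũ_η = weilDilate η ũ`). [cite: Bombieri2000Weil, §4 proof of Thm 5 (the dilation)] -/
def weilDilationDefect (a : ℝ) (u : ℝ → ℂ) (η : ℝ) : ℝ → ℂ :=
  weilDilate η (weilTrunc a u) - weilTrunc a u

/-- Pointwise vanishing at every `|x| ≥ a` gives vanishing off `Icc (-a) a`. [folklore] -/
theorem eq_zero_of_notMem_Icc_of_abs (hfs : ∀ x, a ≤ |x| → f x = 0) :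
    ∀ x, x ∉ Icc (-a) a → f x = 0 :=
  fun x hx ↦ hfs x (not_le.1 fun h ↦ hx (abs_le.1 h)).le

/-- Finite archimedean energy is preserved under subtraction on `L²`. [folklore] -/
theorem finiteEnergy_sub (hf : MemLp f 2) (hh : MemLp h 2)
    (hEf : IntegrableOn (fun t ↦ weilArchDensity t * weilIncrement f t) (Ioi 0))
    (hEh : IntegrableOn (fun t ↦ weilArchDensity t * weilIncrement h t) (Ioi 0)) :
    IntegrableOn (fun t ↦ weilArchDensity t * weilIncrement (f - h) t) (Ioi 0) := by
  have e : f - h = f + (-1 : ℝ) • h := by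
    funext x
    simp [sub_eq_add_neg]
  rw [e]
  exact dt_finiteEnergy_add hf (hh.const_smul _) hEf (dt_finiteEnergy_smul _ h hEh)

/-- `‖f + h‖² = ‖f‖² + ‖h‖² + 2 Re⟨f, h⟩` in `L²`. [folklore] -/
theorem integral_norm_sq_add_eq (hf : MemLp f 2) (hh : MemLp h 2) :
    ∫ x, ‖(f + h) x‖ ^ 2 =
      (∫ x, ‖f x‖ ^ 2) + (∫ x, ‖h x‖ ^ 2) + 2 * ∫ x, (f x * conj (h x)).re := by
  have hif : Integrable fun x ↦ ‖f x‖ ^ 2 := (memLp_two_iff_integrable_sq_norm hf.1).1 hf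
  have hih : Integrable fun x ↦ ‖h x‖ ^ 2 := (memLp_two_iff_integrable_sq_norm hh.1).1 hh
  have hir : Integrable fun x ↦ (f x * conj (h x)).re := dt_integrable_mul_conj_re hf hh
  have e : ∀ x, ‖(f + h) x‖ ^ 2 = (‖f x‖ ^ 2 + ‖h x‖ ^ 2) + 2 * (f x * conj (h x)).re :=
    fun x ↦ by rw [Pi.add_apply, dt_norm_add_sq]
  have hsum : Integrable (fun x ↦ ‖f x‖ ^ 2 + ‖h x‖ ^ 2) := hif.add hih
  have h2 : Integrable (fun x ↦ 2 * (f x * conj (h x)).re) := hir.const_mul 2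
  simp_rw [e]
  rw [integral_add hsum h2, integral_add hif hih, integral_const_mul]

/-! ## Positivity, the ground state at the bottom, polarisation -/

/-- **`D_a ≥ 0` on the finite-energy window class** (`stub_formDomainPos`: `C_c^∞` is dense from
above in the form domain). [cite: Bombieri2000Weil, §4 Thm 3] -/
theorem windowDefectForm_nonneg (ha : 0 < a) (hf : MemLp f 2) (hfs : ∀ x, a ≤ |x| → f x = 0)
    (hE : IntegrableOn (fun t ↦ weilArchDensity t * weilIncrement f t) (Ioi 0)) :
    0 ≤ windowDefectForm a f := by
  have h := stub_formDomainPos a ha f hf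
    (Eventually.of_forall (eq_zero_of_notMem_Icc_of_abs hfs)) hE
  unfold windowDefectForm
  linarith

/-- **The ground state sits at the bottom**: `D_a(ũ) = 0` for `ũ = weilTrunc a u`, `u` any ground
state of the window `a` (`stub_groundStateEnergy` + `stub_formDomainPos`, `‖ũ‖ = 1`).
[cite: Bombieri2000Weil, §4 Thm 3] -/
theorem windowDefectForm_weilTrunc (hu : IsWeilGroundState a u) :
    windowDefectForm a (weilTrunc a u) = 0 := by
  have ha : 0 < a := hu.pos
  have hvg : IsWeilGroundState a (weilTrunc a u) := isWeilGroundState_weilTrunc hu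
  obtain ⟨hvE, hC2⟩ := stub_groundStateEnergy a _ hvg
  have hvs : ∀ x, a ≤ |x| → weilTrunc a u x = 0 := fun x hx ↦ weilTrunc_eq_zero u hx
  have h1 := windowDefectForm_nonneg ha hvg.memLp hvs hvE
  unfold windowDefectForm at h1 ⊢
  linarith

/-- **Polarisation along a real line**: `D_a(f + s h) = D_a(f) + 2s D_a(f, h) + s² D_a(h)` on the
finite-energy window class. [folklore] -/
theorem windowDefectForm_add_smul (hf : MemLp f 2) (hh : MemLp h 2)
    (hfs : ∀ x, a ≤ |x| → f x = 0) (hhs : ∀ x, a ≤ |x| → h x = 0)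
    (hEf : IntegrableOn (fun t ↦ weilArchDensity t * weilIncrement f t) (Ioi 0))
    (hEh : IntegrableOn (fun t ↦ weilArchDensity t * weilIncrement h t) (Ioi 0)) (s : ℝ) :
    windowDefectForm a (f + s • h) =
      windowDefectForm a f + 2 * s * windowDefectForm₂ a f h + s ^ 2 * windowDefectForm a h := by
  have hsh : MemLp (s • h) 2 := hh.const_smul s
  have hshs : ∀ x, a ≤ |x| → (s • h) x = 0 := fun x hx ↦ by
    rw [dt_smul_apply, hhs x hx, mul_zero]
  have hEsh := dt_finiteEnergy_smul s h hEh
  have hP := dt_weilPoleForm_add hf hsh (eq_zero_of_notMem_Icc_of_abs hfs)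
    (eq_zero_of_notMem_Icc_of_abs hshs)
  have hE := dt_weilDirichletEnergy_add a hf hsh hEf hEsh
  have hN := integral_norm_sq_add_eq hf hsh
  have hP2 : weilPoleForm₂ f (s • h) = s * weilPoleForm₂ f h := by
    rw [dt_weilPoleForm₂_comm, dt_weilPoleForm₂_smul_left, dt_weilPoleForm₂_comm]
  have hE2 : weilDirichletEnergy₂ a f (s • h) = s * weilDirichletEnergy₂ a f h := by
    rw [dt_weilDirichletEnergy₂_comm, dt_weilDirichletEnergy₂_smul_left,
      dt_weilDirichletEnergy₂_comm]
  have hN2 : ∫ x, (f x * conj ((s • h) x)).re = s * ∫ x, (f x * conj (h x)).re := by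
    rw [dt_pairing_comm f (s • h), dt_pairing_smul_left, dt_pairing_comm h f]
  unfold windowDefectForm windowDefectForm₂
  rw [hP, hE, hN, hP2, hE2, hN2, dt_weilPoleForm_smul, dt_weilDirichletEnergy_smul,
    dt_integral_norm_sq_smul]
  ring

/-- **Cauchy–Schwarz for the window defect form**: `D_a(f, h)² ≤ D_a(f) D_a(h)` on the
finite-energy window class (discriminant of the nonnegative quadratic `s ↦ D_a(f + s h)`).
[folklore] -/
theorem windowDefectForm₂_sq_le (ha : 0 < a) (hf : MemLp f 2) (hh : MemLp h 2)
    (hfs : ∀ x, a ≤ |x| → f x = 0) (hhs : ∀ x, a ≤ |x| → h x = 0)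
    (hEf : IntegrableOn (fun t ↦ weilArchDensity t * weilIncrement f t) (Ioi 0))
    (hEh : IntegrableOn (fun t ↦ weilArchDensity t * weilIncrement h t) (Ioi 0)) :
    windowDefectForm₂ a f h ^ 2 ≤ windowDefectForm a f * windowDefectForm a h := by
  have hq : ∀ s : ℝ, 0 ≤ windowDefectForm a h * (s * s) + 2 * windowDefectForm₂ a f h * s +
      windowDefectForm a f := by
    intro s
    have hsh : MemLp (s • h) 2 := hh.const_smul s
    have h0 := windowDefectForm_nonneg ha (hf.add hsh)
      (fun x hx ↦ by rw [Pi.add_apply, hfs x hx, dt_smul_apply, hhs x hx, mul_zero, add_zero])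
      (dt_finiteEnergy_add hf hsh hEf (dt_finiteEnergy_smul s h hEh))
    rw [windowDefectForm_add_smul hf hh hfs hhs hEf hEh] at h0
    have e : s ^ 2 = s * s := sq s
    rw [e] at h0
    linarith
  have hd := discrim_le_zero hq
  rw [discrim] at hd
  nlinarith [hd]

/-- **First variation at the ground state**: `D_a(ũ, h) = 0` for every `h` of the finite-energy
window class (`D_a(ũ) = 0`, `D_a ≥ 0`, Cauchy–Schwarz) — the Euler–Lagrange equation of the ground
state in closed-form language. [cite: Bombieri2000Weil, §4 Thm 3] -/
theorem windowDefectForm₂_weilTrunc (hu : IsWeilGroundState a u) (hh : MemLp h 2)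
    (hhs : ∀ x, a ≤ |x| → h x = 0)
    (hEh : IntegrableOn (fun t ↦ weilArchDensity t * weilIncrement h t) (Ioi 0)) :
    windowDefectForm₂ a (weilTrunc a u) h = 0 := by
  have ha : 0 < a := hu.pos
  have hvg : IsWeilGroundState a (weilTrunc a u) := isWeilGroundState_weilTrunc hu
  have hvE := (stub_groundStateEnergy a _ hvg).1
  have hvs : ∀ x, a ≤ |x| → weilTrunc a u x = 0 := fun x hx ↦ weilTrunc_eq_zero u hx
  have h1 := windowDefectForm₂_sq_le ha hvg.memLp hh hvs hhs hvE hEh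
  rw [windowDefectForm_weilTrunc hu, zero_mul] at h1
  exact (pow_eq_zero_iff two_ne_zero).1 (le_antisymm h1 (sq_nonneg _))

/-- **Pythagoras at the bottom**: `D_a(g) = D_a(g − ũ)` for every `g` of the finite-energy window
class — the defect energy of a trial state is the defect energy of its difference from the ground
state. [folklore] -/
theorem windowDefectForm_eq_sub_weilTrunc (hu : IsWeilGroundState a u) (hg : MemLp g 2)
    (hgs : ∀ x, a ≤ |x| → g x = 0)
    (hEg : IntegrableOn (fun t ↦ weilArchDensity t * weilIncrement g t) (Ioi 0)) :
    windowDefectForm a g = windowDefectForm a (g - weilTrunc a u) := by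
  have ha : 0 < a := hu.pos
  have hvg : IsWeilGroundState a (weilTrunc a u) := isWeilGroundState_weilTrunc hu
  have hv2 : MemLp (weilTrunc a u) 2 := hvg.memLp
  have hvE := (stub_groundStateEnergy a _ hvg).1
  have hvs : ∀ x, a ≤ |x| → weilTrunc a u x = 0 := fun x hx ↦ weilTrunc_eq_zero u hx
  have hw2 : MemLp (g - weilTrunc a u) 2 := hg.sub hv2
  have hws : ∀ x, a ≤ |x| → (g - weilTrunc a u) x = 0 := fun x hx ↦ by
    rw [Pi.sub_apply, hgs x hx, hvs x hx, sub_zero]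
  have hwE := finiteEnergy_sub hg hv2 hEg hvE
  have hexp := windowDefectForm_add_smul hv2 hw2 hvs hws hvE hwE 1
  rw [one_smul, windowDefectForm_weilTrunc hu, windowDefectForm₂_weilTrunc hu hw2 hws hwE,
    add_sub_cancel] at hexp
  rw [hexp]
  ring

/-! ## The dilation defect -/

/-- The dilation defect is in `L²`. [folklore] -/
theorem memLp_weilDilationDefect (hu : MemLp u 2) {η : ℝ} (hη : -1 < η) :
    MemLp (weilDilationDefect a u η) 2 :=
  (memLp_weilDilate (hu.indicator measurableSet_Ioo) hη).sub (hu.indicator measurableSet_Ioo)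

/-- For `η ≥ 0` the dilation defect vanishes at every `|x| ≥ a` (`a ≥ 0`). [folklore] -/
theorem weilDilationDefect_eq_zero (ha : 0 ≤ a) {η : ℝ} (hη : 0 ≤ η) {x : ℝ} (hx : a ≤ |x|) :
    weilDilationDefect a u η x = 0 := by
  have hη' : -1 < η := by linarith
  have hvs : ∀ y, a ≤ |y| → weilTrunc a u y = 0 := fun y hy ↦ weilTrunc_eq_zero u hy
  unfold weilDilationDefect
  rw [Pi.sub_apply, hvs x hx, sub_zero]
  exact weilDilate_eq_zero_of_le_abs hη' hvs ((div_le_self ha (by linarith)).trans hx)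

/-- In the two EDGE LAYERS `a/(1+η) ≤ |x|` the dilation defect is `−ũ` (`η > -1`). [folklore] -/
theorem weilDilationDefect_eq_neg {η : ℝ} (hη : -1 < η) {x : ℝ} (hx : a / (1 + η) ≤ |x|) :
    weilDilationDefect a u η x = -weilTrunc a u x := by
  have hvs : ∀ y, a ≤ |y| → weilTrunc a u y = 0 := fun y hy ↦ weilTrunc_eq_zero u hy
  unfold weilDilationDefect
  rw [Pi.sub_apply, weilDilate_eq_zero_of_le_abs hη hvs hx, zero_sub]

/-- The dilation defect of a ground state has finite archimedean energy (`0 ≤ η ≤ 1`). [folklore] -/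
theorem integrableOn_arch_weilDilationDefect (hu : IsWeilGroundState a u) {η : ℝ} (hη : 0 ≤ η)
    (hη1 : η ≤ 1) :
    IntegrableOn (fun t ↦ weilArchDensity t * weilIncrement (weilDilationDefect a u η) t)
      (Ioi 0) := by
  have ha : 0 < a := hu.pos
  have hη' : -1 < η := by linarith
  have hvg : IsWeilGroundState a (weilTrunc a u) := isWeilGroundState_weilTrunc hu
  have hv2 : MemLp (weilTrunc a u) 2 := hvg.memLp
  have hvE := (stub_groundStateEnergy a _ hvg).1
  have hvs : ∀ x, a ≤ |x| → weilTrunc a u x = 0 := fun x hx ↦ weilTrunc_eq_zero u hx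
  exact finiteEnergy_sub (memLp_weilDilate hv2 hη') hv2
    (integrableOn_arch_weilDilate ha hη' hη1 hv2 hvs hvE) hvE

/-- **The profile read at the window `a`**: for `η ≥ 0`,
`weilDilationProfile a u η − ε(a) = D_a(ũ_η)` (`‖ũ_η‖ = 1`; the closed form does not depend on
the reference window beyond the support radius, `stub_localizedCut_energy_window`).
[cite: Bombieri2000Weil, §4 proof of Thm 5 (the dilation)] -/
theorem weilDilationProfile_sub_eq_windowDefectForm (hu : IsWeilGroundState a u) {η : ℝ}
    (hη : 0 ≤ η) :
    weilDilationProfile a u η - weilGroundEnergy a =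
      windowDefectForm a (weilDilate η (weilTrunc a u)) := by
  have ha : 0 < a := hu.pos
  have hη' : -1 < η := by linarith
  have hvg : IsWeilGroundState a (weilTrunc a u) := isWeilGroundState_weilTrunc hu
  have hv2 : MemLp (weilTrunc a u) 2 := hvg.memLp
  have hvs : ∀ x, a ≤ |x| → weilTrunc a u x = 0 := fun x hx ↦ weilTrunc_eq_zero u hx
  have hg2 : MemLp (weilDilate η (weilTrunc a u)) 2 := memLp_weilDilate hv2 hη'
  have hgs : ∀ x, a ≤ |x| → weilDilate η (weilTrunc a u) x = 0 := fun x hx ↦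
    weilDilate_eq_zero_of_le_abs hη' hvs ((div_le_self ha.le (by linarith)).trans hx)
  have hgN : ∫ x, ‖weilDilate η (weilTrunc a u) x‖ ^ 2 = 1 := by
    rw [integral_norm_sq_weilDilate _ hη', hvg.integral_norm_sq]
  have hW := stub_localizedCut_energy_window hg2 (by linarith : a ≤ 2 * a) hgs
  rw [hgN, mul_one, mul_one] at hW
  unfold weilDilationProfile weilClosedForm windowDefectForm
  rw [hgN, mul_one, mul_one]
  linarith

/-- **THE DEFECT IDENTITY.** For every ground state `u` of the window `a` and `0 ≤ η ≤ 1`: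
`weilDilationProfile a u η − ε(a) = D_a(w_η)`, `w_η = ũ_η − ũ` the dilation defect — the excess of
the dilation profile over the ground level is exactly the defect energy of the dilation defect
(profile read at the window, then Pythagoras at the bottom). [cite: Bombieri2000Weil, §4 Thm 3 and proof of Thm 5] -/
theorem weilDilationProfile_sub_weilGroundEnergy (hu : IsWeilGroundState a u) {η : ℝ} (hη : 0 ≤ η)
    (hη1 : η ≤ 1) :
    weilDilationProfile a u η - weilGroundEnergy a = windowDefectForm a (weilDilationDefect a u η) := by
  have ha : 0 < a := hu.pos
  have hη' : -1 < η := by linarith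
  have hvg : IsWeilGroundState a (weilTrunc a u) := isWeilGroundState_weilTrunc hu
  have hv2 : MemLp (weilTrunc a u) 2 := hvg.memLp
  have hvE := (stub_groundStateEnergy a _ hvg).1
  have hvs : ∀ x, a ≤ |x| → weilTrunc a u x = 0 := fun x hx ↦ weilTrunc_eq_zero u hx
  have hg2 : MemLp (weilDilate η (weilTrunc a u)) 2 := memLp_weilDilate hv2 hη'
  have hgs : ∀ x, a ≤ |x| → weilDilate η (weilTrunc a u) x = 0 := fun x hx ↦
    weilDilate_eq_zero_of_le_abs hη' hvs ((div_le_self ha.le (by linarith)).trans hx)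
  have hgE := integrableOn_arch_weilDilate ha hη' hη1 hv2 hvs hvE
  rw [weilDilationProfile_sub_eq_windowDefectForm hu hη,
    windowDefectForm_eq_sub_weilTrunc hu hg2 hgs hgE]
  rfl

/-- The dilation defect of a ground state has nonnegative defect energy (`0 ≤ η ≤ 1`). [folklore] -/
theorem windowDefectForm_weilDilationDefect_nonneg (hu : IsWeilGroundState a u) {η : ℝ}
    (hη : 0 ≤ η) (hη1 : η ≤ 1) : 0 ≤ windowDefectForm a (weilDilationDefect a u η) :=
  windowDefectForm_nonneg hu.pos (memLp_weilDilationDefect hu.memLp (by linarith))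
    (fun _ hx ↦ weilDilationDefect_eq_zero hu.pos.le hη hx)
    (integrableOn_arch_weilDilationDefect hu hη hη1)

/-- **VIRIAL = DEFECT RATE.** If the dilation profile of a ground state `u` of the window `a` has
a derivative `V` at `η = 0` (its dilation virial), then `D_a(w_η)/η → V` as `η → 0⁺`
(contact `weilDilationProfile_zero` + the defect identity). [folklore] -/
theorem tendsto_windowDefectForm_weilDilationDefect_div (hu : IsWeilGroundState a u) {V : ℝ}
    (hV : HasDerivAt (weilDilationProfile a u) V 0) :
    Tendsto (fun η ↦ windowDefectForm a (weilDilationDefect a u η) / η) (𝓝[>] 0) (𝓝 V) := by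
  refine hV.tendsto_slope_zero_right.congr' ?_
  filter_upwards [Ioo_mem_nhdsGT (zero_lt_one' ℝ)] with η hη
  rw [zero_add, weilDilationProfile_zero hu, smul_eq_mul,
    weilDilationProfile_sub_weilGroundEnergy hu hη.1.le hη.2.le, div_eq_inv_mul]

/-- **The virial is a one-sided limit of nonnegative defect energies**, hence `V ≥ 0` whenever it
exists (consistent with `ε′ ≤ 0`: `V = −a ε′(a)`). [folklore] -/
theorem virial_nonneg_of_hasDerivAt (hu : IsWeilGroundState a u) {V : ℝ}
    (hV : HasDerivAt (weilDilationProfile a u) V 0) : 0 ≤ V :=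
  ge_of_tendsto (tendsto_windowDefectForm_weilDilationDefect_div hu hV) <| by
    filter_upwards [Ioo_mem_nhdsGT (zero_lt_one' ℝ)] with η hη
    exact div_nonneg (windowDefectForm_weilDilationDefect_nonneg hu hη.1.le hη.2.le) hη.1.le

end Summit.RiemannHypothesis.RiemannHypothesis.Theorems.PfPersistence

end
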